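import Mathlib
import HarnessLib

/-!
# Route `GenusKolyvaginAtTwo`, crux L_T `PowDvdShaCardAtTwoRT` (stmt-BirchSwinnertonDyer-23242), LINE 18 stub 3a⁗ —
# ONE RUNG OF THE SUPPLY from McCallum's Prop. 5.2: the Selmer-currency `havoid`/`hsupply` binder of the ladder on one side of the
# ℚ-pair, from Prop. 5.2 over `K` at the right depth (every arithmetic input displayed)

LEAD seat `bsd-line-gk2-p1` g15 (cell `bsd-f1-sign2`), `--supports stmt-BirchSwinnertonDyer-23242` (helper). Mathlib-only; THEOREMS ONLY.
BSD is not proved by this file; neither is the crux or the stub.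

WHY (memo `Cruxes/PowDvdShaCardAtTwoRT/Lines/plus-descent-lead-g15-v2.md` §3/§6/§7). The exhibition half of L_T runs the avoidance ladder on
each member of the ℚ-pair `(E, E^{(d_K)})` (gk2-p2's `pow_dvd_natCard_primaryComponent_sha_of_selmer_avoidance` /
`two_mul_sum_le_padicValNat_sha_of_forall_relaxed_supply_heegner`), whose input at rung `j` is: «every `≤ 2j(+budget)` Selmer classes are
avoided by a Selmer class of order-divisibility `2^{M_{r−1} − M_r}`» (`r` the depth assigned to the rung on that side). McCallum p. 285
+ Prop. 5.2 supply it: Prop. 5.2 at depth `r` over `K` gives a product `n` of `r` deep Kolyvagin primes with `m(n) = M_r` whose class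
avoids the restriction of the given classes; `z_K := 2^{L−M_{r−1}} c_L(n) = c_{M_{r−1}}(n)` is SELMER over `K` (Lemma 4.3 off `n`; at
`λ ∣ n` Prop. 4.4 with `m(n/ℓ) ≥ M_{r−1}`, minimality), of order `2^{M_{r−1}−M_r}` (cyclic order law `ord c_L(n) = 2^{L−m(n)}`), `τ`-eigen
with the side's sign, hence the restriction of a unique ℚ-class `z` (restriction injective with image the eigenclasses — gk2-p3
`existsUnique_resTorsion_eq_of_conjAct_eq`, `E(K)[2] = 0`), and `⟨z⟩ ∩ ⟨s⟩ = 0` because `res` is injective and `⟨z_K⟩ ≤ ⟨c_L(n)⟩`.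
THIS FILE is that deduction with the arithmetic displayed as hypotheses:
* `rungSupply_of_prop52` — from (h52) Prop. 5.2 at depth `r` for subgroups generated by `≤ 2j` Selmer classes, (hord) the order law,
  (hsel) the Selmer criterion, (hmin) minimality at depth `r−1`, (hsign)+(hres) the descent dictionary: the `havoid` binder at rung `j`
  in the currency `res⁻¹(Sel_K)` of the ℚ-side ladder.

References: [McCallumLMS1991] §5 p. 285 (the elements `d_{M_{r−1}}(n)`), Prop. 5.2, Lemma 4.3, Prop. 4.4, Lemma 4.6; [Kolyvagin1991MathAnn] Thm. 2.2.
-/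

set_option autoImplicit false
-- `Summit.<P>.<Sub>` repeats `BirchSwinnertonDyer` by the tree's layout convention (D-0017)
set_option linter.dupNamespace false

namespace Summit.BirchSwinnertonDyer.BirchSwinnertonDyer.Theorems.GenusExact.PlusDescent

open AddSubgroup

section Rung

variable {U V : Type*} [AddCommGroup U] [AddCommGroup V]

/-- Order of `2^a • x` when `ord x = 2^b`, `a ≤ b`: `2^(b−a)`. [folklore] -/
theorem addOrderOf_two_pow_smul_of_addOrderOf_eq {x : V} {a b : ℕ} (hab : a ≤ b) (hx : addOrderOf x = 2 ^ b) :
    addOrderOf ((2 ^ a : ℤ) • x) = 2 ^ (b - a) := by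
  have h2a : (2 ^ a : ℕ) ≠ 0 := pow_ne_zero a two_ne_zero
  have : ((2 ^ a : ℕ) : ℤ) • x = (2 ^ a : ℤ) • x := by push_cast; rfl
  rw [← this, natCast_zsmul, addOrderOf_nsmul_of_dvd h2a (hx ▸ pow_dvd_pow 2 hab), hx, Nat.pow_div hab two_pos]

/-- **ONE RUNG OF THE SUPPLY FROM PROP. 5.2.** Data: ℚ-classes `U`, `K`-classes `V`, the restriction `res : U →+ V` (injective, with
image the `τ`-eigenclasses of the side's sign `ε`: `hres`), the Selmer group `Sel ≤ V`, Kolyvagin classes `cls S ∈ V` of the deep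
square-free products `S` (admissibility `adm` per prime), their divisibility indices `m S ≤ L`, the depth `r ≥ 1` of the rung with the
minima `Mcur = M_r` (current) and `Mprev = M_{r−1} ≥ Mcur`, `Mprev ≤ L` (for `r = 0` the hypothesis `hmin` is vacuous-false unless `Mprev ≤ m ∅`, so the statement is only used with `r ≥ 1`). Hypotheses: `hord` (`ord c_L(n) = 2^{L − m(n)}`); `hsel`
(`2^{L−M′} c_L(n)` is Selmer once `m(n/ℓ) ≥ M′` for all `ℓ ∣ n`: Lemma 4.3 + Prop. 4.4 + Lemma 4.6); `hmin` (minimality of `Mprev` among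
admissible products of `r − 1` primes); `hsign` (classes of depth `r` are `ε`-eigen); `h52` (Prop. 5.2 at depth `r` against subgroups
generated by at most `2j` Selmer classes). Conclusion: the rung-`j` `havoid` binder of the ℚ-side Selmer ladder, in `res⁻¹(Sel)`:
every `≤ 2j` classes of `res⁻¹(Sel)` are avoided by a class of `res⁻¹(Sel)` of order-divisibility `2^{Mprev − Mcur}`.
[cite: McCallumLMS1991, §5 p. 285 and Prop. 5.2; Lemma 4.3, Prop. 4.4, Lemma 4.6] -/
theorem rungSupply_of_prop52
    (res : U →+ V) (hinj : Function.Injective res) (τ : V →+ V) (ε : ℤ)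
    (hres : ∀ x : V, τ x = ε • x → ∃ u : U, res u = x)
    (Sel : AddSubgroup V) (adm : ℕ → Prop) (cls : Finset ℕ → V) (m : Finset ℕ → ℕ) (L r Mprev Mcur j : ℕ)
    (hMM : Mcur ≤ Mprev) (hML : Mprev ≤ L)
    (hord : ∀ S : Finset ℕ, (∀ ℓ ∈ S, adm ℓ) → m S ≤ L ∧ addOrderOf (cls S) = 2 ^ (L - m S))
    (hsel : ∀ (S : Finset ℕ) (M' : ℕ), (∀ ℓ ∈ S, adm ℓ) → M' ≤ L → (∀ ℓ ∈ S, M' ≤ m (S.erase ℓ)) →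
      (2 ^ (L - M') : ℤ) • cls S ∈ Sel)
    (hmin : ∀ S : Finset ℕ, S.card = r - 1 → (∀ ℓ ∈ S, adm ℓ) → Mprev ≤ m S)
    (hsign : ∀ S : Finset ℕ, S.card = r → (∀ ℓ ∈ S, adm ℓ) → τ (cls S) = ε • cls S)
    (h52 : ∀ s : Finset V, (↑s : Set V) ⊆ Sel → s.card ≤ 2 * j →
      ∃ S : Finset ℕ, S.card = r ∧ (∀ ℓ ∈ S, adm ℓ) ∧ m S = Mcur ∧
        Disjoint (zmultiples (cls S)) (closure (s : Set V))) :
    ∀ s : Finset U, (↑s : Set U) ⊆ Sel.comap res → s.card ≤ 2 * j →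
      ∃ z ∈ Sel.comap res, 2 ^ (Mprev - Mcur) ∣ addOrderOf z ∧ Disjoint (zmultiples z) (closure (s : Set U)) := by
  classical
  intro s hs hcard
  -- Prop. 5.2 against the restrictions of `s`
  have hsV : (↑(s.image res) : Set V) ⊆ Sel := by
    rw [Finset.coe_image]
    rintro _ ⟨u, hu, rfl⟩
    exact hs hu
  obtain ⟨S, hScard, hadm, hmS, hdisj⟩ := h52 (s.image res) hsV (Finset.card_image_le.trans hcard)
  obtain ⟨-, hordS⟩ := hord S hadm
  -- `z_K := 2^{L - Mprev} • c_L(n)` is Selmer (minimality at depth `r-1` + the Selmer criterion)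
  set zK : V := (2 ^ (L - Mprev) : ℤ) • cls S with hzK
  have hzKsel : zK ∈ Sel := by
    refine hsel S Mprev hadm hML fun ℓ hℓ ↦ hmin (S.erase ℓ) ?_ fun l hl ↦ hadm l (Finset.mem_of_mem_erase hl)
    rw [Finset.card_erase_of_mem hℓ, hScard]
  -- it is an eigenclass, hence a restriction
  have hzKτ : τ zK = ε • zK := by
    rw [hzK, map_zsmul, hsign S hScard hadm, smul_comm]
  obtain ⟨z, hz⟩ := hres zK hzKτ
  refine ⟨z, ?_, ?_, ?_⟩
  · -- `z ∈ res⁻¹(Sel)`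
    rw [AddSubgroup.mem_comap, hz]
    exact hzKsel
  · -- `ord z = ord z_K = 2^{(L - Mcur) - (L - Mprev)} = 2^{Mprev - Mcur}`
    rw [← addOrderOf_injective res hinj z, hz, hzK, addOrderOf_two_pow_smul_of_addOrderOf_eq (by omega) (hmS ▸ hordS)]
    have : L - Mcur - (L - Mprev) = Mprev - Mcur := by omega
    rw [this]
  · -- avoidance: `res` is injective and `⟨z_K⟩ ≤ ⟨c_L(n)⟩` avoids `⟨res s⟩ = res ⟨s⟩`
    rw [AddSubgroup.disjoint_def]
    intro x hxz hxs
    have hresx : res x ∈ zmultiples (cls S) := by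
      rw [mem_zmultiples_iff] at hxz ⊢
      obtain ⟨k, rfl⟩ := hxz
      exact ⟨k * 2 ^ (L - Mprev), by rw [map_zsmul, hz, hzK, smul_smul]⟩
    have hresx' : res x ∈ closure (↑(s.image res) : Set V) := by
      rw [Finset.coe_image, ← AddMonoidHom.map_closure]
      exact AddSubgroup.mem_map_of_mem res hxs
    have h0 : res x = 0 := by
      have := (AddSubgroup.disjoint_def.mp hdisj) hresx hresx'
      exact this
    exact hinj (by rw [h0, map_zero])

end Rung

end Summit.BirchSwinnertonDyer.BirchSwinnertonDyer.Theorems.GenusExact.PlusDescent
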